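import Summits.Ventures.PercRepro.RankDistSeriesClass

/-!
# PercRepro — SERIES-DEGENERATE CELLS OF THE TIGHT LAYER: a series class of the maximal size `p − q + 2` makes the
shadow profile `c · (C(k, 1), C(k, 2), …, C(k, k − 2), k + 1)` — the profile of `U_{k−1,k}` — and the symmetry
`s_u = s_{n−u}` an equality (p9, gen 22)

Tight layer: `|E| = p + q`, `ρ(E) = p`, bottom sets `𝓑 = PerFlat.Uq M p q`, shadow levels
`s_u = #∂_u 𝓑 = #{A ⊇ some B ∈ 𝓑 : ρ(A) = u}`; `S` a series class (every two elements a cocircuit, no coloops) of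
the maximal size `k := |S| = p − q + 2` (`RankDistSeriesClass`: then `𝓑 = 𝓑₀ × S` and `M|(E ∖ S)` is SQUARE — rank
`q − 1` on `2q − 2` elements). The members of the up-set of `𝓑` are the `A₀ ∪ T` with `A₀ ∈ 𝓤₀ := coreUp M p q S`
(the subsets of `E ∖ S` containing the `S`-free part of a bottom set — all of rank `q − 1`, all spanning `E ∖ S`:
`rk_of_mem_coreUp`) and `∅ ≠ T ⊆ S`, of rank `q − 1 + |T|` for `T ⊊ S` (`rk_union_of_mem_coreUp`) and `p` for
`T = S` (`rk_union_self_of_mem_coreUp`); every such `A₀ ∪ T` contains a bottom set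
(`exists_mem_Uq_subset_union_of_mem_coreUp`). Hence, with `c := #𝓤₀`:
* **`s_u = c · C(k, u − q + 1)` for every `q ≤ u < p`** (`card_shadowLev_of_series`), by the bijection
  `A ↦ (A ∖ S, A ∩ S)` onto `𝓤₀ × {T ⊆ S : |T| = u − q + 1}`;
* **`s_p = c · (k + 1)`** (`card_shadowLev_top_of_series`: the parts `T` with `|T| ≥ k − 1`);
* **the symmetry `s_u = s_{p+q−u}` holds with EQUALITY for every `q < u < p`** (`card_shadowLev_symm_of_series`).
This is the equality locus of the lane's symmetry leg as the census sees it (kit j309397: the cells `(17, 10, 7)`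
with `s = (6090, 12180, 12180, 7308) = 1218·(5, 10, 10, 6)` and `(21, 12, 9)` with
`s = 11718·(5, 10, 10, 6)` both carry a series class of five edges; the `(SC)` minima `(16, 9, 7)`,
`(18, 10, 8)`, `(20, 11, 9)` carry one of four: `s = c·(4, 6, 5)`), and the `(SC)` slack on these cells is exactly
`C(k, 2)·C(n, q) / (k·C(n, p − 1)) = (k − 1)(q + 1) / (2(q + k − 2))`. Nothing here moves any window of the crux.
-/

namespace PercRepro.RankDist

open Set Finset _root_.Matroid PercRepro.ThmH

variable {α : Type} (M : Matroid α) [M.Finite] [DecidableEq α]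

/-! ## The core up-set and the members of the shadow -/

open scoped Classical in
/-- **The core up-set** `𝓤₀` of a series-degenerate cell: the subsets of `E ∖ S` containing the `S`-free part of
some bottom set. -/
noncomputable def coreUp (p q : ℕ) (S : Finset α) : Finset (Set α) :=
  (subsetsFin M).filter
    (fun A₀ => A₀ ⊆ M.E \ (S : Set α) ∧ ∃ B ∈ PerFlat.Uq M p q, (B : Set α) \ (S : Set α) ⊆ A₀)

open scoped Classical in
/-- Membership in the core up-set. -/
lemma mem_coreUp {p q : ℕ} {S : Finset α} {A₀ : Set α} :
    A₀ ∈ coreUp M p q S ↔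
      A₀ ⊆ M.E \ (S : Set α) ∧ ∃ B ∈ PerFlat.Uq M p q, (B : Set α) \ (S : Set α) ⊆ A₀ := by
  unfold coreUp
  rw [Finset.mem_filter, mem_subsetsFin]
  constructor
  · rintro ⟨-, h⟩
    exact h
  · intro h
    exact ⟨h.1.trans Set.sdiff_subset, h⟩

/-- Every member of the core up-set has rank `q − 1` and spans `E ∖ S`. -/
lemma rk_of_mem_coreUp {p q : ℕ} (hn : (gr M).card = p + q) (hr : M.eRank = (p : ℕ∞)) {S : Finset α}
    (hSE : (S : Set α) ⊆ M.E) (hser : ∀ x ∈ S, ∀ y ∈ S, x ≠ y → M.IsCocircuit {x, y})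
    (hnc : ∀ x ∈ S, ¬ M.IsColoop x) (hS2 : 2 ≤ S.card) (hk : S.card + q = p + 2) {A₀ : Set α}
    (hA₀ : A₀ ∈ coreUp M p q S) : rk M A₀ + 1 = q ∧ M.E \ (S : Set α) ⊆ M.closure A₀ := by
  obtain ⟨hA₀E, B, hB, hBA⟩ := (mem_coreUp M).1 hA₀
  obtain ⟨-, hrkB₀, -⟩ := mem_Uq_series_degenerate M hn hr hSE hser hnc hS2 hk hB
  have hE0 := rk_ground_sdiff_of_series_degenerate M hr hSE hser hnc hS2 hk
  have hA₀E' : A₀ ⊆ M.E := hA₀E.trans Set.sdiff_subset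
  have h1 : rk M A₀ ≤ rk M (M.E \ (S : Set α)) := rk_mono_of_subset M hA₀E Set.sdiff_subset
  have h2 : rk M ((B : Set α) \ (S : Set α)) ≤ rk M A₀ := rk_mono_of_subset M hBA hA₀E'
  refine ⟨by omega, ?_⟩
  have hfin : M.IsRkFinite A₀ := RankFinite.isRkFinite _
  have hle : M.eRk (M.E \ (S : Set α)) ≤ M.eRk A₀ := by
    rw [eRk_eq_coe_rk M Set.sdiff_subset, eRk_eq_coe_rk M hA₀E']
    exact_mod_cast (by omega : rk M (M.E \ (S : Set α)) ≤ rk M A₀)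
  rw [hfin.closure_eq_closure_of_subset_of_eRk_ge_eRk hA₀E hle]
  exact M.subset_closure _ Set.sdiff_subset

/-- `A₀ ∈ 𝓤₀`, `T ⊆ S ∖ x`: `ρ(A₀ ∪ T) + 1 = q + |T|`. -/
lemma rk_union_of_mem_coreUp {p q : ℕ} (hn : (gr M).card = p + q) (hr : M.eRank = (p : ℕ∞)) {S : Finset α}
    (hSE : (S : Set α) ⊆ M.E) (hser : ∀ x ∈ S, ∀ y ∈ S, x ≠ y → M.IsCocircuit {x, y})
    (hnc : ∀ x ∈ S, ¬ M.IsColoop x) (hS2 : 2 ≤ S.card) (hk : S.card + q = p + 2) {A₀ : Set α}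
    (hA₀ : A₀ ∈ coreUp M p q S) {x : α} (hx : x ∈ S) {T : Finset α} (hT : T ⊆ S.erase x) :
    rk M (A₀ ∪ (T : Set α)) + 1 = q + T.card := by
  obtain ⟨hrk, -⟩ := rk_of_mem_coreUp M hn hr hSE hser hnc hS2 hk hA₀
  rw [rk_union_eq_of_series M hSE hser ((mem_coreUp M).1 hA₀).1 hx hT]
  omega

/-- `A₀ ∈ 𝓤₀`: `ρ(A₀ ∪ S) = p`. -/
lemma rk_union_self_of_mem_coreUp {p q : ℕ} (hn : (gr M).card = p + q) (hr : M.eRank = (p : ℕ∞))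
    {S : Finset α} (hSE : (S : Set α) ⊆ M.E) (hser : ∀ x ∈ S, ∀ y ∈ S, x ≠ y → M.IsCocircuit {x, y})
    (hnc : ∀ x ∈ S, ¬ M.IsColoop x) (hS2 : 2 ≤ S.card) (hk : S.card + q = p + 2) {A₀ : Set α}
    (hA₀ : A₀ ∈ coreUp M p q S) : rk M (A₀ ∪ (S : Set α)) = p := by
  obtain ⟨hrk, hspan⟩ := rk_of_mem_coreUp M hn hr hSE hser hnc hS2 hk hA₀
  obtain ⟨s, hs⟩ := Finset.card_pos.1 (by omega : 0 < S.card)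
  have h := rk_union_self_eq_of_series M hSE hser hnc ((mem_coreUp M).1 hA₀).1 hspan hs
  omega

/-- `A₀ ∈ 𝓤₀`, `∅ ≠ T ⊆ S`: `A₀ ∪ T` contains a bottom set (the `S`-free part of one, plus any element of `T`). -/
lemma exists_mem_Uq_subset_union_of_mem_coreUp {p q : ℕ} (hn : (gr M).card = p + q) (hr : M.eRank = (p : ℕ∞))
    {S : Finset α} (hSE : (S : Set α) ⊆ M.E) (hser : ∀ x ∈ S, ∀ y ∈ S, x ≠ y → M.IsCocircuit {x, y})
    (hnc : ∀ x ∈ S, ¬ M.IsColoop x) (hS2 : 2 ≤ S.card) (hk : S.card + q = p + 2) {A₀ : Set α}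
    (hA₀ : A₀ ∈ coreUp M p q S) {T : Finset α} (hT : T ⊆ S) (hne : T.Nonempty) :
    ∃ B ∈ PerFlat.Uq M p q, (B : Set α) ⊆ A₀ ∪ (T : Set α) := by
  obtain ⟨-, B, hB, hBA⟩ := (mem_coreUp M).1 hA₀
  obtain ⟨t, ht⟩ := hne
  refine ⟨(B \ S) ∪ {t}, sdiff_union_singleton_mem_Uq_of_series M hn hr hSE hser hnc hS2 hk hB (hT ht), ?_⟩
  intro z hz
  rw [Finset.coe_union, Finset.coe_sdiff, Finset.coe_singleton] at hz
  rcases hz with hz | hz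
  · exact Or.inl (hBA hz)
  · rw [Set.mem_singleton_iff] at hz
    rw [hz]
    exact Or.inr (Finset.mem_coe.2 ht)

open scoped Classical in
/-- The `S`-free part of a shadow set lies in the core up-set. -/
lemma sdiff_mem_coreUp_of_mem_shadowLev {p q u : ℕ} {S : Finset α} {A : Set α}
    (hA : A ∈ shadowLev M u (PerFlat.Uq M p q)) : A \ (S : Set α) ∈ coreUp M p q S := by
  obtain ⟨hAE, -, B, hB, hBA⟩ := (mem_shadowLev M).1 hA
  rw [mem_coreUp]
  exact ⟨sdiff_coe_subset_ground_sdiff M hAE, B, hB, Set.sdiff_subset_sdiff_left hBA⟩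

/-! ## The shadow profile: `s_u = c · C(k, u − q + 1)` below the top, `s_p = c · (k + 1)` -/

open scoped Classical in
/-- **THE SHADOW LEVELS OF A SERIES-DEGENERATE CELL BELOW THE TOP**: `|S| + q = p + 2`, `S` pairwise in series
without coloops, `q ≤ u < p`: `s_u = #𝓤₀ · C(|S|, u − q + 1)` — the bijection `A ↦ (A ∖ S, A ∩ S)` onto
`𝓤₀ × {T ⊆ S : |T| = u − q + 1}`. -/
theorem card_shadowLev_of_series {p q : ℕ} (hn : (gr M).card = p + q) (hr : M.eRank = (p : ℕ∞)) {S : Finset α}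
    (hSE : (S : Set α) ⊆ M.E) (hser : ∀ x ∈ S, ∀ y ∈ S, x ≠ y → M.IsCocircuit {x, y})
    (hnc : ∀ x ∈ S, ¬ M.IsColoop x) (hS2 : 2 ≤ S.card) (hk : S.card + q = p + 2) {u : ℕ} (hqu : q ≤ u)
    (hup : u < p) :
    (shadowLev M u (PerFlat.Uq M p q)).card = (coreUp M p q S).card * S.card.choose (u - q + 1) := by
  rw [← Finset.card_powersetCard, ← Finset.card_product]
  refine Finset.card_bij' (fun A _ => (A \ (S : Set α), S.filter (fun x => x ∈ A)))
    (fun P _ => P.1 ∪ (P.2 : Set α)) ?_ ?_ ?_ ?_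
  · intro A hA
    have hA₀ := sdiff_mem_coreUp_of_mem_shadowLev M (S := S) hA
    obtain ⟨hAE, hrkA, -⟩ := (mem_shadowLev M).1 hA
    rw [Finset.mem_product, Finset.mem_powersetCard]
    dsimp only
    refine ⟨hA₀, Finset.filter_subset _ _, ?_⟩
    obtain ⟨hrkA₀, hspan⟩ := rk_of_mem_coreUp M hn hr hSE hser hnc hS2 hk hA₀
    have hA₀E : A \ (S : Set α) ⊆ M.E \ (S : Set α) := sdiff_coe_subset_ground_sdiff M hAE
    set T := S.filter (fun x => x ∈ A) with hT
    have hTS : T ⊆ S := Finset.filter_subset _ _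
    have hdec : A \ (S : Set α) ∪ (T : Set α) = A := by
      rw [hT]
      exact sdiff_union_filter_eq S A
    by_cases hTeq : T = S
    · exfalso
      obtain ⟨s, hs⟩ := Finset.card_pos.1 (by omega : 0 < S.card)
      have h := rk_union_self_eq_of_series M hSE hser hnc hA₀E hspan hs
      rw [hTeq] at hdec
      rw [hdec] at h
      omega
    · obtain ⟨x, hxS, hxT⟩ := Finset.exists_of_ssubset (Finset.ssubset_iff_subset_ne.2 ⟨hTS, hTeq⟩)
      have hTx : T ⊆ S.erase x := fun z hz => Finset.mem_erase.2 ⟨fun h => hxT (h ▸ hz), hTS hz⟩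
      have h := rk_union_eq_of_series M hSE hser hA₀E hxS hTx
      rw [hdec] at h
      omega
  · rintro ⟨A₀, T⟩ hP
    rw [Finset.mem_product, Finset.mem_powersetCard] at hP
    dsimp only at hP
    obtain ⟨hA₀, hTS, hTcard⟩ := hP
    have hA₀E := ((mem_coreUp M).1 hA₀).1
    have hTne : T.Nonempty := Finset.card_pos.1 (by omega)
    have hTne' : T ≠ S := by
      intro h
      rw [h] at hTcard
      omega
    obtain ⟨x, hxS, hxT⟩ := Finset.exists_of_ssubset (Finset.ssubset_iff_subset_ne.2 ⟨hTS, hTne'⟩)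
    have hTx : T ⊆ S.erase x := fun z hz => Finset.mem_erase.2 ⟨fun h => hxT (h ▸ hz), hTS hz⟩
    rw [mem_shadowLev]
    dsimp only
    refine ⟨Set.union_subset (hA₀E.trans Set.sdiff_subset)
      (fun z hz => hSE (Finset.mem_coe.2 (hTS (Finset.mem_coe.1 hz)))), ?_,
      exists_mem_Uq_subset_union_of_mem_coreUp M hn hr hSE hser hnc hS2 hk hA₀ hTS hTne⟩
    have h := rk_union_of_mem_coreUp M hn hr hSE hser hnc hS2 hk hA₀ hxS hTx
    omega
  · intro A _
    exact sdiff_union_filter_eq S A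
  · rintro ⟨A₀, T⟩ hP
    rw [Finset.mem_product, Finset.mem_powersetCard] at hP
    dsimp only at hP
    obtain ⟨hA₀, hTS, -⟩ := hP
    have hA₀E := ((mem_coreUp M).1 hA₀).1
    simp only [Prod.mk.injEq]
    constructor
    · ext z
      simp only [Set.mem_sdiff, Set.mem_union, Finset.mem_coe]
      constructor
      · rintro ⟨hz | hz, hzS⟩
        · exact hz
        · exact absurd (hTS hz) hzS
      · intro hz
        exact ⟨Or.inl hz, (hA₀E hz).2⟩
    · ext z
      simp only [Finset.mem_filter, Set.mem_union, Finset.mem_coe]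
      constructor
      · rintro ⟨hzS, hz | hz⟩
        · exact absurd hzS (hA₀E hz).2
        · exact hz
      · intro hz
        exact ⟨hTS hz, Or.inr hz⟩

/-- The parts `T ⊆ S` with at least `|S| − 1` elements: there are `|S| + 1` of them. -/
lemma card_powerset_filter_pred_le (S : Finset α) (hS : 1 ≤ S.card) :
    (S.powerset.filter (fun T => S.card ≤ T.card + 1)).card = S.card + 1 := by
  have h : S.powerset.filter (fun T => S.card ≤ T.card + 1)
      = S.powersetCard (S.card - 1) ∪ S.powersetCard S.card := by
    ext T
    simp only [Finset.mem_filter, Finset.mem_powerset, Finset.mem_union, Finset.mem_powersetCard]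
    constructor
    · rintro ⟨hT, hc⟩
      have := Finset.card_le_card hT
      by_cases h : T.card = S.card
      · exact Or.inr ⟨hT, h⟩
      · exact Or.inl ⟨hT, by omega⟩
    · rintro (⟨hT, hc⟩ | ⟨hT, hc⟩)
      · exact ⟨hT, by omega⟩
      · exact ⟨hT, by omega⟩
  have hdisj : Disjoint (S.powersetCard (S.card - 1)) (S.powersetCard S.card) := by
    rw [Finset.disjoint_left]
    intro T h1 h2
    rw [Finset.mem_powersetCard] at h1 h2
    omega
  rw [h, Finset.card_union_of_disjoint hdisj, Finset.card_powersetCard, Finset.card_powersetCard,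
    Nat.choose_self, Nat.choose_symm hS, Nat.choose_one_right]

open scoped Classical in
/-- **THE TOP SHADOW LEVEL OF A SERIES-DEGENERATE CELL**: `s_p = #𝓤₀ · (|S| + 1)` — the parts `T ⊆ S` with
`|T| ≥ |S| − 1`. -/
theorem card_shadowLev_top_of_series {p q : ℕ} (hn : (gr M).card = p + q) (hr : M.eRank = (p : ℕ∞))
    {S : Finset α} (hSE : (S : Set α) ⊆ M.E) (hser : ∀ x ∈ S, ∀ y ∈ S, x ≠ y → M.IsCocircuit {x, y})
    (hnc : ∀ x ∈ S, ¬ M.IsColoop x) (hS2 : 2 ≤ S.card) (hk : S.card + q = p + 2) :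
    (shadowLev M p (PerFlat.Uq M p q)).card = (coreUp M p q S).card * (S.card + 1) := by
  rw [← card_powerset_filter_pred_le S (by omega), ← Finset.card_product]
  have hE0 := rk_ground_sdiff_of_series_degenerate M hr hSE hser hnc hS2 hk
  refine Finset.card_bij' (fun A _ => (A \ (S : Set α), S.filter (fun x => x ∈ A)))
    (fun P _ => P.1 ∪ (P.2 : Set α)) ?_ ?_ ?_ ?_
  · intro A hA
    have hA₀ := sdiff_mem_coreUp_of_mem_shadowLev M (S := S) hA
    obtain ⟨hAE, hrkA, -⟩ := (mem_shadowLev M).1 hA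
    rw [Finset.mem_product, Finset.mem_filter, Finset.mem_powerset]
    dsimp only
    refine ⟨hA₀, Finset.filter_subset _ _, ?_⟩
    obtain ⟨hrkA₀, hspan⟩ := rk_of_mem_coreUp M hn hr hSE hser hnc hS2 hk hA₀
    have hA₀E : A \ (S : Set α) ⊆ M.E \ (S : Set α) := sdiff_coe_subset_ground_sdiff M hAE
    set T := S.filter (fun x => x ∈ A) with hT
    have hTS : T ⊆ S := Finset.filter_subset _ _
    have hdec : A \ (S : Set α) ∪ (T : Set α) = A := by
      rw [hT]
      exact sdiff_union_filter_eq S A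
    by_cases hTeq : T = S
    · rw [hTeq]
      omega
    · obtain ⟨x, hxS, hxT⟩ := Finset.exists_of_ssubset (Finset.ssubset_iff_subset_ne.2 ⟨hTS, hTeq⟩)
      have hTx : T ⊆ S.erase x := fun z hz => Finset.mem_erase.2 ⟨fun h => hxT (h ▸ hz), hTS hz⟩
      have h := rk_union_eq_of_series M hSE hser hA₀E hxS hTx
      rw [hdec] at h
      omega
  · rintro ⟨A₀, T⟩ hP
    rw [Finset.mem_product, Finset.mem_filter, Finset.mem_powerset] at hP
    dsimp only at hP
    obtain ⟨hA₀, hTS, hTcard⟩ := hP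
    have hA₀E := ((mem_coreUp M).1 hA₀).1
    have hTne : T.Nonempty := Finset.card_pos.1 (by omega)
    rw [mem_shadowLev]
    dsimp only
    refine ⟨Set.union_subset (hA₀E.trans Set.sdiff_subset)
      (fun z hz => hSE (Finset.mem_coe.2 (hTS (Finset.mem_coe.1 hz)))), ?_,
      exists_mem_Uq_subset_union_of_mem_coreUp M hn hr hSE hser hnc hS2 hk hA₀ hTS hTne⟩
    by_cases hTeq : T = S
    · rw [hTeq]
      exact rk_union_self_of_mem_coreUp M hn hr hSE hser hnc hS2 hk hA₀
    · obtain ⟨x, hxS, hxT⟩ := Finset.exists_of_ssubset (Finset.ssubset_iff_subset_ne.2 ⟨hTS, hTeq⟩)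
      have hTx : T ⊆ S.erase x := fun z hz => Finset.mem_erase.2 ⟨fun h => hxT (h ▸ hz), hTS hz⟩
      have h := rk_union_of_mem_coreUp M hn hr hSE hser hnc hS2 hk hA₀ hxS hTx
      have hlt : T.card < S.card := Finset.card_lt_card (Finset.ssubset_iff_subset_ne.2 ⟨hTS, hTeq⟩)
      omega
  · intro A _
    exact sdiff_union_filter_eq S A
  · rintro ⟨A₀, T⟩ hP
    rw [Finset.mem_product, Finset.mem_filter, Finset.mem_powerset] at hP
    dsimp only at hP
    obtain ⟨hA₀, hTS, -⟩ := hP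
    have hA₀E := ((mem_coreUp M).1 hA₀).1
    simp only [Prod.mk.injEq]
    constructor
    · ext z
      simp only [Set.mem_sdiff, Set.mem_union, Finset.mem_coe]
      constructor
      · rintro ⟨hz | hz, hzS⟩
        · exact hz
        · exact absurd (hTS hz) hzS
      · intro hz
        exact ⟨Or.inl hz, (hA₀E hz).2⟩
    · ext z
      simp only [Finset.mem_filter, Set.mem_union, Finset.mem_coe]
      constructor
      · rintro ⟨hzS, hz | hz⟩
        · exact absurd hzS (hA₀E hz).2
        · exact hz
      · intro hz
        exact ⟨hTS hz, Or.inr hz⟩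

/-- **THE SYMMETRY IS AN EQUALITY ON THE SERIES-DEGENERATE CELLS**: `s_u = s_{p+q−u}` for every `q < u < p`. -/
theorem card_shadowLev_symm_of_series {p q : ℕ} (hn : (gr M).card = p + q) (hr : M.eRank = (p : ℕ∞))
    {S : Finset α} (hSE : (S : Set α) ⊆ M.E) (hser : ∀ x ∈ S, ∀ y ∈ S, x ≠ y → M.IsCocircuit {x, y})
    (hnc : ∀ x ∈ S, ¬ M.IsColoop x) (hS2 : 2 ≤ S.card) (hk : S.card + q = p + 2) {u : ℕ} (hqu : q < u)
    (hup : u < p) :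
    (shadowLev M u (PerFlat.Uq M p q)).card = (shadowLev M (p + q - u) (PerFlat.Uq M p q)).card := by
  rw [card_shadowLev_of_series M hn hr hSE hser hnc hS2 hk hqu.le hup,
    card_shadowLev_of_series M hn hr hSE hser hnc hS2 hk (by omega) (by omega)]
  congr 1
  have h : p + q - u - q + 1 = S.card - (u - q + 1) := by omega
  rw [h, Nat.choose_symm (by omega)]

end PercRepro.RankDist
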